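import Summits.BirchSwinnertonDyer.BirchSwinnertonDyer.Theorems.Rank1ResidualJetSwapLevelRaising
import Summits.BirchSwinnertonDyer.BirchSwinnertonDyer.Theorems.Rank1ResidualJetCarrierEndFormsLiteratureNoCV
import Summits.BirchSwinnertonDyer.BirchSwinnertonDyer.Theorems.Rank1ResidualJetKolyvaginLocalTermClosed
import Summits.BirchSwinnertonDyer.BirchSwinnertonDyer.Theorems.ClassRecordThreeEulerHalvesAtThreeWalkSupplyDisjoint
import Summits.BirchSwinnertonDyer.BirchSwinnertonDyer.Theorems.Rank1ResidualJetWeilDatum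
import Summits.BirchSwinnertonDyer.BirchSwinnertonDyer.Theorems.Rank1ResidualJetCoreVertexBridge
import Summits.BirchSwinnertonDyer.Rank1Residual.JET.RingClassTransverseLagrangian
import Summits.BirchSwinnertonDyer.Rank1Residual.JET.TransverseFamilyConjAct
import Literature.NumberTheory.EllipticCurves.HeegnerPointsKolyvaginExceptionalSelmerProofs
import Literature.NumberTheory.EllipticCurves.WeilPairingTateDual
import HarnessLib

/-!
# T1 JET (cell `bsd-jet`), road K — striking McCallum 1991 Prop. 5.2 (`h52`), brick 7: «LEVEL RAISING
# AT MINIMAL DEPTH» (`hR`) FROM THE LITERATURE — every structural input of brick 4 supplied by name;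
# residual named print = {Poitou–Tate for Selmer structures, F1 = [GZ86 III (3.1)], (γ) = Gross 3.7 (2)}

HONEST FRAMING (programme file §HONESTY, verbatim): «no tranche here proves BSD; ARM L moves the
LITERAL column of an r ≤ 1 census into the kernel-proved-modulo-named-print column.» THEOREMS ONLY
(seat `bsd-jet-pv-2`, session g6; `--supports stmt-BirchSwinnertonDyer-14418`, helper); 0 classes move;
road-K DOCUMENTARY. Nothing is asserted about any curve; no item closes.

WHAT. `levelRaising_of_literature hPT hF1 h372 : hR` — the hypothesis `hR` of bricks 5/5b/6a/6b/6c
(level raising at minimal depth, quantified over the frame) PROVED from three named Literature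
statements, by brick 4 `Swap.exists_conductor_levelIndex_ge_of_minDepth` (Kolyvagin's prime-swap walk
in the kernel) with its level-`p` structural inputs supplied as in cell bsd-stepL's assembly
(`…WalkSupplyAtThreeBsdJetGaps`, there at `3^k`): the Poitou–Tate package `inv` from `hPT K (p^1)`;
a `τ`-equivariant Weil datum (`JET.exists_weilDatum_liftAut`); the global intrinsic transverse family
(`Walk.exists_globalTransverseFamily`) with `h𝒯σ` (`Walk.globalTransverse_conjActPlace_mem` ∘ lit-ty's
`forall_conjActPlace_mem_of_eq_iInf_transverseSubgroup`), `h𝒯sd` (`Walk.globalTransverse_dualTransported_eq`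
∘ ty's `RingClassTransverse.dualTransported_eq_of_localTransverseFamily`), `hloc` (pv-1's
`kolyvaginLocalTerm_of_poitouTate`), `hdisj` (`Walk.globalTransverse_disjoint_kummer` ∘ stepL's
`disjoint_kummer_iInf_transverseSubgroup`); [GZ86 III (3.1)] guarded from F1 (ty's
`JET.forall_hGZ_of_Gross1991 hF1`); McCallum 4.4 from (γ) (ty's `JET.prop44_of_frobeniusCongruence h372`,
through cell bsd-stepL corner-p1's kernel body). References (locators only): [cite: McCallumLMS1991,
§5 Prop. 5.2 and proof (pp. 304–306), §4 Prop. 4.4] [cite: Jetchev2008, Lemma 5.1, Lemma 5.2, Thm. 5.1]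
[cite: GrossLMS1991, Prop. 3.7 (2), §6 Prop. 6.2 (1)] [cite: GrossZagier1986, III (3.1)]
[cite: MilneADT2006, Ch. I, Thm. 4.10(b)]. Design: no definitions; `K : Type`. Axioms: `propext`,
`Classical.choice`, `Quot.sound`.
-/

set_option autoImplicit false

noncomputable section

open scoped Classical Pointwise
open Function NumberField IsDedekindDomain WeierstrassCurve Field
open Literature.NumberTheory.EllipticCurves Literature.NumberTheory.GaloisRepresentations
open Literature.NumberTheory.EllipticCurves.Jetchev2008 Literature.NumberTheory.EllipticCurves.KolyvaginCocycle
open Literature.NumberTheory.EllipticCurves.ModularForms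
open Literature.NumberTheory.GaloisCohomology Literature.NumberTheory.Automorphic
open Literature.NumberTheory.GaloisRepresentations.DiscreteGaloisModule (transverseSubgroup SelmerStructure)
open Summit.BirchSwinnertonDyer.Rank1Residual.JET.SelmerVocabulary
open Summit.BirchSwinnertonDyer.Rank1Residual.JET.GlobalDuality
open Summit.BirchSwinnertonDyer.Rank1Residual.X11b
open Summit.BirchSwinnertonDyer.Rank1Residual.X11b.Three
open Summit.BirchSwinnertonDyer.BirchSwinnertonDyer.Theorems

namespace Summit.BirchSwinnertonDyer.Rank1Residual.JET.Swap

set_option maxHeartbeats 800000 in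
/-- **LEVEL RAISING AT MINIMAL DEPTH from three named Literature statements** (`hR` of bricks 5–6):
Kolyvagin's prime-swap walk (brick 4) with the Poitou–Tate package, a Weil datum, the global intrinsic
transverse family and its four local facts, [GZ86 III (3.1)] (guarded, from F1) and McCallum 4.4 (from
Gross 3.7 (2)) all supplied by name. [cite: McCallumLMS1991, §5 Prop. 5.2 (p. 304)]
[cite: Jetchev2008, Lemma 5.1, Lemma 5.2 (iii)] [cite: GrossZagier1986, III (3.1)] -/
theorem levelRaising_of_literature
    (hPT : ∀ (K : Type) [Field K] [NumberField K], poitouTate_selmerStructure_duality_conj K)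
    (hF1 : Gross1991_heegnerPoint_sub_ratTorsion_mem_E0)
    (h372 : GrossLMS1991.prop37_2_frobeniusCongruence) :
    ∀ (W : WeierstrassCurve ℚ) [W.IsElliptic] [W.IsGloballyMinimal] [NeZero (W.conductorNorm ℤ)],
      ¬ W.HasCM → ∀ (K : Type) [Field K] [NumberField K], IsImaginaryQuadratic K →
      NumberField.discr K ≠ -3 → NumberField.discr K ≠ -4 →
      SatisfiesHeegnerHypothesis (W.conductorNorm ℤ) K →
      ∀ (p : ℕ) [Fact p.Prime], p ≠ 2 → (∀ n : ℕ, W.HasSurjectiveModNGaloisRep (p ^ n : ℕ)) →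
      ∀ (Dt : ModularParametrizationData W (W.conductorNorm ℤ)) (β : ℤ) (ι : K →+* ℂ) (u : ℕ),
      (∀ (c : ℕ), Squarefree c →
        (∀ q ∈ c.primeFactors, Zhang2014.IsKolyvaginPrime (W.conductorNorm ℤ) W K p q ∧
          1 + u ≤ Zhang2014.kolyvaginIndex W p q) →
        ∀ dc : KolyvaginHeegnerData Dt β ι c,
        ∃ Q : (W.baseChange (ringClassField K ι c)).toAffine.Point,
          ((p ^ u : ℕ) : ℤ) • Q = dc.derivedPoint) →
      ∀ (n₀ : ℕ), Squarefree n₀ →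
        (∀ q ∈ n₀.primeFactors, Zhang2014.IsKolyvaginPrime (W.conductorNorm ℤ) W K p q ∧
          1 + u ≤ Zhang2014.kolyvaginIndex W p q) →
        ∀ d₀ : KolyvaginHeegnerData Dt β ι n₀,
        (¬ ∃ Q : (W.baseChange (ringClassField K ι n₀)).toAffine.Point,
          ((p ^ (u + 1) : ℕ) : ℤ) • Q = d₀.derivedPoint) →
        ∀ m' : ℕ, ∃ (n : ℕ) (d : KolyvaginHeegnerData Dt β ι n), Squarefree n ∧
          (∀ q ∈ n.primeFactors, Zhang2014.IsKolyvaginPrime (W.conductorNorm ℤ) W K p q ∧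
            max m' (1 + u) ≤ Zhang2014.kolyvaginIndex W p q) ∧
          ¬ ∃ Q : (W.baseChange (ringClassField K ι n)).toAffine.Point,
            ((p ^ (u + 1) : ℕ) : ℤ) • Q = d.derivedPoint := by
  intro W _ _ _ hcm K _ _ hK hD3 hD4 hH p _ hp2 htower Dt β ι u hmin n₀ hn₀ hn₀K d₀ hd₀ m'
  have hp : p.Prime := Fact.out
  have hD : NumberField.discr K < -4 := KolyvaginAssembly.discr_lt_neg_four hK ⟨hD3, hD4⟩
  have hρ : W.HasSurjectiveModNGaloisRep p := by simpa using htower 1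
  haveI : ∀ j : ℕ, NumberField (ringClassField K ι j) := numberField_ringClassField K hK ι
  obtain ⟨τ, hτ⟩ := exists_algEquiv_ne_one_of_isImaginaryQuadratic K hK
  have hττ : τ * τ = 1 := mul_self_eq_one_of_isImaginaryQuadratic hK τ
  -- instances at level `p`
  haveI : NeZero (p ^ 1) := ⟨pow_ne_zero 1 hp.ne_zero⟩
  haveI : Finite (geomTorsion (W.baseChange K) ((p ^ 1 : ℕ) : ℤ)) :=
    finite_geomTorsion_of_neZero (W.baseChange K) (p ^ 1)
  -- the Poitou–Tate package and a `τ`-equivariant Weil datum at level `p`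
  obtain ⟨inv, hperf, hvan, -, hSC, hconj⟩ := hPT K (p ^ 1)
  have h2 : 2 ≤ p ^ 1 := by rw [pow_one]; exact hp.two_le
  obtain ⟨e, hμ, hadd₁, hadd₂, hgal, halt, hnondeg, hτe⟩ := exists_weilDatum_liftAut W τ (p ^ 1) h2
  -- the global intrinsic transverse family at level `p` and its local facts
  obtain ⟨𝒯, h𝒯, -⟩ := Walk.exists_globalTransverseFamily W ι ((p ^ 1 : ℕ) : ℤ)
  have h𝒯σ' : ∀ (c : ℕ), Squarefree c →
      (∀ q ∈ c.primeFactors, Zhang2014.IsKolyvaginPrime (W.conductorNorm ℤ) W K p q) →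
      ∀ (v w : HeightOneSpectrum (𝓞 K)) (h : τ • v = w), v ∈ placesDividing K c →
      ∀ x : galoisCohomology (((W.baseChange K).torsionGaloisModule ((p ^ 1 : ℕ) : ℤ)).toLocal
        (Sum.inr v : Place K)) 1,
      x ∈ 𝒯 (Sum.inr v) → conjActPlace W τ ((p ^ 1 : ℕ) : ℤ) h x ∈ 𝒯 (Sum.inr w) :=
    fun c hc _ v w h hv x hx ↦ Walk.globalTransverse_conjActPlace_mem h𝒯 τ hc
      (forall_conjActPlace_mem_of_eq_iInf_transverseSubgroup W hK ι τ _ c) v w h hv x hx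
  have h𝒯sd' : ∀ (c : ℕ), Squarefree c →
      (∀ q ∈ c.primeFactors, Zhang2014.IsKolyvaginPrime (W.conductorNorm ℤ) W K p q) →
      ∀ v ∈ placesDividing K c,
      inv.dualTransported 𝒯 (weilDualIntertwining (W.baseChange K) (p ^ 1) e hμ hadd₁ hadd₂ hgal)
        (Sum.inr v) = 𝒯 (Sum.inr v) :=
    fun c hc hcK ↦ Walk.globalTransverse_dualTransported_eq (ι := ι) h𝒯 hc
      (fun 𝒯c h𝒯c inv' hperf' w' hw' ↦
        RingClassTransverse.dualTransported_eq_of_localTransverseFamily W K hK hD ι p hp2 1 le_rfl c hc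
          hcK (fun ℓ hℓ ↦ (hcK ℓ hℓ).2.2.2.2.2) 𝒯c h𝒯c e hμ hadd₁ hadd₂ hgal halt hnondeg inv' hperf' w' hw')
      inv hperf
  have hloc' : ∀ ℓ : ℕ, Zhang2014.IsKolyvaginPrime (W.conductorNorm ℤ) W K p ℓ →
      1 ≤ Zhang2014.kolyvaginIndex W p ℓ →
      ∀ (v : HeightOneSpectrum (𝓞 K)), (ℓ : 𝓞 K) ∈ v.asIdeal → ∀ (hfix : τ • v = v) (s : ℤ),
      (s = 1 ∨ s = -1) →
      ((W.baseChange K).kummerSelmerStructure ((p ^ 1 : ℕ) : ℤ) (Sum.inr v)).relIndex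
        ((conjActPlace W τ ((p ^ 1 : ℕ) : ℤ) hfix - s • AddMonoidHom.id _).ker) = p ^ 1 :=
    fun ℓ hℓ hk v hv hfix s hs ↦
      kolyvaginLocalTerm_of_poitouTate hPT W K hK τ hτ p 1 hp2 le_rfl ℓ hℓ hk v hv hfix s hs
  have hdisj' : ∀ ℓ : ℕ, Zhang2014.IsKolyvaginPrime (W.conductorNorm ℤ) W K p ℓ →
      ∀ v : HeightOneSpectrum (𝓞 K), (ℓ : 𝓞 K) ∈ v.asIdeal →
      Disjoint ((W.baseChange K).kummerSelmerStructure ((p ^ 1 : ℕ) : ℤ) (Sum.inr v)) (𝒯 (Sum.inr v)) :=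
    fun ℓ hℓ v hv ↦ Walk.globalTransverse_disjoint_kummer h𝒯
      (P := fun ℓ ↦ Zhang2014.IsKolyvaginPrime (W.conductorNorm ℤ) W K p ℓ)
      (fun ℓ hℓ w hw ↦ Walk.disjoint_kummer_iInf_transverseSubgroup W K hK hD ι 1 hℓ w hw)
      (fun ℓ hℓ ↦ hℓ.1) ℓ hℓ v hv
  -- [GZ86 III (3.1)] (guarded) from F1; McCallum 4.4 from Gross 3.7 (2)
  obtain ⟨n', hcop', hGZ'⟩ := forall_hGZ_of_Gross1991 hF1 W K hK hD3 hD4 hH p hp2 hρ Dt β ι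
  exact exists_conductor_levelIndex_ge_of_minDepth W τ p e hμ hadd₁ hadd₂ hgal halt hnondeg hτe hK hD3
    hD4 hH hcm hp2 htower hτ hττ Dt β ι (prop44_of_frobeniusCongruence h372) inv hperf hvan hSC (hconj τ)
    𝒯 h𝒯 h𝒯σ' h𝒯sd' hloc' hdisj' hcop' hGZ' hmin hn₀ hn₀K d₀ hd₀ m'

end Summit.BirchSwinnertonDyer.Rank1Residual.JET.Swap

end
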